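import Summits.ValiantsHypothesis.ValiantsHypothesis.Theses.ProjectionStability
import Summits.ValiantsHypothesis.ValiantsHypothesis.Theorems.ProjectionStabilityOptStepStubGrenetProjection
import Summits.ValiantsHypothesis.ValiantsHypothesis.Theorems.ProjectionStabilityOptStepStubHalfEqOfUniq
import Summits.ValiantsHypothesis.ValiantsHypothesis.Theorems.ProjectionStabilityUniqStepStubLrEqualityNormalForm
import Summits.ValiantsHypothesis.ValiantsHypothesis.Theorems.ProjectionStabilityUniqStepStubOrbitProportional
import Summits.ValiantsHypothesis.ValiantsHypothesis.Theorems.ProjectionStabilityUniqStepStubGradedRigidity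
import Summits.ValiantsHypothesis.ValiantsHypothesis.Theorems.ProjectionStabilityUniqStepStubSwapBookkeeping

/-!
# Crux `UniqStep` (stmt-ValiantsHypothesis-17834), line `Sketch` — the SYMMETRY REDUCTION:
# at Grenet's size, uniqueness of optimal projections of the permanent IS left-monomial symmetry,
# and the crux `UniqStep` is EQUIVALENT to "half-symmetry propagates one level up"

WHAT. Write `Opt N := 2^N − 1 ≤ pdc(per_N)`, `Uniq N :=` any two honest optimal (`pdc × pdc`)
projections of `per_N` are related by constant gauge, a substitution in `permSymmetrySubst ℂ N` and
possibly transposition (the clause of the route, verbatim), and `HalfEq N :=` every honest optimal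
projection `D` of `per_N` is an exactly-lifted `leftMonomialSubst ℂ N`-equivariant representation of
`per_N`, or its variable-transpose `D.map (rename Prod.swap)` is.  Then:

* `uniq_of_halfEq` (`N ≥ 3`, `Opt N`): `HalfEq N → Uniq N`.  Proof = the line's provable half: a
  half-equivariant optimal projection has size `2^N − 1` (Grenet is a strict projection,
  `stub_grenetProjection`), i.e. EQUALITY in Landsberg–Ressayre Thm. 2.8; by the landed stubs it is
  gauge-equivalent to a generalised Grenet matrix (`stub_lrEqualityNormalForm`), whose level forms are
  proportional (`stub_orbitProportional`), hence it is `permSymmetrySubst`-equivalent to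
  `Grenet.repr` (`stub_gradedRigidity`); the variable-transpose is in the same class
  (`stub_swapBookkeeping`).  So all optimal projections lie in ONE class.
* with the OptStep line's `stub_halfEq_of_uniq` (`Uniq N → HalfEq N`, any `N ≥ 1` with `Opt N`):
  `halfEq_iff_uniq` — **for `N ≥ 3` with Grenet optimal, Landsberg–Ressayre's Question 2.2 ("does an
  optimal expression respect the symmetry?") and uniqueness of the optimal expression are the SAME
  question** in Valiant's projection model.
* `uniqStep_iff_symStep` and `uniqStep_iff_halfEq_step`: the crux is equivalent to the line's bet
  (`Opt n → Uniq n → Opt (n+1) → HalfEq (n+1)`) and to the pure symmetry-propagation statement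
  `Opt n → HalfEq n → Opt (n+1) → HalfEq (n+1)` (`n ≥ 3`).

WHY. This is the composition `UniqStep_of` of the skeleton `Cruxes/UniqStep/Lines/Sketch.lean` with its
six landed stubs inlined, recorded as theorems so that the remaining open statement (the bet S7) is
pinned down in the tree in its sharpest form.  No `sorry`, no named facts, no new definitions.

SOURCE. Landsberg–Ressayre 2017 (arXiv:1508.05788) Thm. 2.8 and Question 2.2; Grenet 2011 Thm. 1;
Hüttenhain–Ikenmeyer 2016 §4 (the (3,7) binary case of uniqueness).
-/

-- D-0017 layout: Sub = Summit for this single-conjunct summit, so the namespace repeats a component.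
set_option linter.dupNamespace false

namespace Summit.ValiantsHypothesis.ValiantsHypothesis.Theorems.ProjectionStabilityUniqStep

open MvPolynomial
open scoped BigOperators Matrix
open Literature.Computability.AlgebraicComplexity

noncomputable section

/-- Under `Opt N` (`N ≥ 1`) the optimal size IS Grenet's: `pdc(per_N) + 1 = 2^N`
(upper bound: Grenet's strict projection, `stub_grenetProjection`). [cite: Grenet2011, Thm. 1] -/
theorem detProjectionComplexity_add_one_eq_two_pow {N : ℕ} (hN : 1 ≤ N)
    (hopt : 2 ^ N - 1 ≤ detProjectionComplexity (perPoly (Fin N) ℂ)) :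
    detProjectionComplexity (perPoly (Fin N) ℂ) + 1 = 2 ^ N := by
  have hle : detProjectionComplexity (perPoly (Fin N) ℂ) ≤ 2 ^ N - 1 :=
    Nat.sInf_le (ProjectionStabilityOptStep.GrenetProjection.stub_grenetProjection N hN)
  have h1 : 1 ≤ 2 ^ N := Nat.one_le_two_pow
  omega

/-- **Every left-monomially symmetric optimal projection of `per_N` is in the class of Grenet's
matrix** (`N ≥ 3`, `Opt N`): the equality case of Landsberg–Ressayre Thm. 2.8 (graded normal form
`stub_lrEqualityNormalForm`, orbit proportionality `stub_orbitProportional`, graded rigidity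
`stub_gradedRigidity`). [cite: LandsbergRessayre2017, Thm. 2.8] -/
theorem detReprEquivalent_grenet_of_isEquivariant {N : ℕ} (hN : 3 ≤ N)
    (hopt : 2 ^ N - 1 ≤ detProjectionComplexity (perPoly (Fin N) ℂ))
    (e : Finset (Fin N) ≃ Fin (detProjectionComplexity (perPoly (Fin N) ℂ) + 1))
    {M : Matrix (Fin (detProjectionComplexity (perPoly (Fin N) ℂ)))
      (Fin (detProjectionComplexity (perPoly (Fin N) ℂ))) (MvPolynomial (Fin N × Fin N) ℂ)}
    (hM : IsEquivariantDetRepr (leftMonomialSubst ℂ N) (perPoly (Fin N) ℂ) M) :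
    DetReprEquivalent (permSymmetrySubst ℂ N) M (Grenet.repr ℂ N e) := by
  have hsz := detProjectionComplexity_add_one_eq_two_pow (by omega : 1 ≤ N) hopt
  obtain ⟨a, hdet, hequiv⟩ := stub_lrEqualityNormalForm N _ hN hsz M hM e
  have hG := hM.of_detReprEquivalent (hequiv.mono bot_le) hdet
  obtain ⟨ρ, α, hprop⟩ := stub_orbitProportional N _ hN hsz e a hG
  exact (hequiv.mono bot_le).trans (stub_gradedRigidity N _ hN hsz e a ρ α hprop hdet)

/-- **Half-symmetry implies uniqueness** (`N ≥ 3`, `Opt N`): if every honest optimal projection of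
`per_N`, or its variable-transpose, is `leftMonomialSubst ℂ N`-equivariant, then any two honest
optimal projections of `per_N` are related by constant gauge, a realised symmetry of `per_N` and
possibly transposition — each lies in the class of `Grenet.repr`, the variable-transpose being in the
same class (`stub_swapBookkeeping`). [cite: LandsbergRessayre2017, Question 2.2] -/
theorem uniq_of_halfEq {N : ℕ} (hN : 3 ≤ N)
    (hopt : 2 ^ N - 1 ≤ detProjectionComplexity (perPoly (Fin N) ℂ))
    (hhalf : ∀ D : Matrix (Fin (detProjectionComplexity (perPoly (Fin N) ℂ)))
        (Fin (detProjectionComplexity (perPoly (Fin N) ℂ))) (MvPolynomial (Fin N × Fin N) ℂ),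
      (∀ i j, (∃ v, D i j = X v) ∨ ∃ c, D i j = C c) → D.det = perPoly (Fin N) ℂ →
      IsEquivariantDetRepr (leftMonomialSubst ℂ N) (perPoly (Fin N) ℂ) D ∨
        IsEquivariantDetRepr (leftMonomialSubst ℂ N) (perPoly (Fin N) ℂ)
          (D.map (rename (Prod.swap : Fin N × Fin N → Fin N × Fin N)))) :
    ∀ A B : Matrix (Fin (detProjectionComplexity (perPoly (Fin N) ℂ)))
        (Fin (detProjectionComplexity (perPoly (Fin N) ℂ))) (MvPolynomial (Fin N × Fin N) ℂ),
      (∀ i j, (∃ v, A i j = MvPolynomial.X v) ∨ ∃ c, A i j = MvPolynomial.C c) →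
      (∀ i j, (∃ v, B i j = MvPolynomial.X v) ∨ ∃ c, B i j = MvPolynomial.C c) →
      A.det = perPoly (Fin N) ℂ → B.det = perPoly (Fin N) ℂ →
      ∃ (P Q : GL (Fin (detProjectionComplexity (perPoly (Fin N) ℂ))) ℂ) (γ : GL (Fin N × Fin N) ℂ),
        γ ∈ permSymmetrySubst ℂ N ∧
        (B = (P : Matrix _ _ ℂ).map MvPolynomial.C * Matrix.linSubstEntries γ A * (Q : Matrix _ _ ℂ).map MvPolynomial.C ∨
          B = (P : Matrix _ _ ℂ).map MvPolynomial.C * (Matrix.linSubstEntries γ A).transpose *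
            (Q : Matrix _ _ ℂ).map MvPolynomial.C) := by
  intro A B hA hB hdA hdB
  have hsz := detProjectionComplexity_add_one_eq_two_pow (by omega : 1 ≤ N) hopt
  have hcard : Fintype.card (Finset (Fin N)) = detProjectionComplexity (perPoly (Fin N) ℂ) + 1 := by
    rw [Fintype.card_finset, Fintype.card_fin, hsz]
  let e : Finset (Fin N) ≃ Fin (detProjectionComplexity (perPoly (Fin N) ℂ) + 1) :=
    Fintype.equivFinOfCardEq hcard
  have key : ∀ M : Matrix (Fin (detProjectionComplexity (perPoly (Fin N) ℂ)))
      (Fin (detProjectionComplexity (perPoly (Fin N) ℂ))) (MvPolynomial (Fin N × Fin N) ℂ),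
      (∀ i j, (∃ v, M i j = X v) ∨ ∃ c, M i j = C c) → M.det = perPoly (Fin N) ℂ →
      DetReprEquivalent (permSymmetrySubst ℂ N) M (Grenet.repr ℂ N e) := by
    intro M hM hdM
    rcases hhalf M hM hdM with hEq | hEq
    · exact detReprEquivalent_grenet_of_isEquivariant hN hopt e hEq
    · exact (stub_swapBookkeeping.2 N _ M).trans (detReprEquivalent_grenet_of_isEquivariant hN hopt e hEq)
  exact (key A hA hdA).trans (key B hB hdB).symm

/-- **At Grenet's size, uniqueness of optimal projections of `per_N` IS half-symmetry** (`N ≥ 3`,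
`Opt N`): combine `uniq_of_halfEq` with the OptStep line's `stub_halfEq_of_uniq`.
[cite: LandsbergRessayre2017, Question 2.2] -/
theorem halfEq_iff_uniq {N : ℕ} (hN : 3 ≤ N)
    (hopt : 2 ^ N - 1 ≤ detProjectionComplexity (perPoly (Fin N) ℂ)) :
    (∀ D : Matrix (Fin (detProjectionComplexity (perPoly (Fin N) ℂ)))
        (Fin (detProjectionComplexity (perPoly (Fin N) ℂ))) (MvPolynomial (Fin N × Fin N) ℂ),
      (∀ i j, (∃ v, D i j = X v) ∨ ∃ c, D i j = C c) → D.det = perPoly (Fin N) ℂ →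
      IsEquivariantDetRepr (leftMonomialSubst ℂ N) (perPoly (Fin N) ℂ) D ∨
        IsEquivariantDetRepr (leftMonomialSubst ℂ N) (perPoly (Fin N) ℂ)
          (D.map (rename (Prod.swap : Fin N × Fin N → Fin N × Fin N)))) ↔
    ∀ A B : Matrix (Fin (detProjectionComplexity (perPoly (Fin N) ℂ)))
        (Fin (detProjectionComplexity (perPoly (Fin N) ℂ))) (MvPolynomial (Fin N × Fin N) ℂ),
      (∀ i j, (∃ v, A i j = MvPolynomial.X v) ∨ ∃ c, A i j = MvPolynomial.C c) →
      (∀ i j, (∃ v, B i j = MvPolynomial.X v) ∨ ∃ c, B i j = MvPolynomial.C c) →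
      A.det = perPoly (Fin N) ℂ → B.det = perPoly (Fin N) ℂ →
      ∃ (P Q : GL (Fin (detProjectionComplexity (perPoly (Fin N) ℂ))) ℂ) (γ : GL (Fin N × Fin N) ℂ),
        γ ∈ permSymmetrySubst ℂ N ∧
        (B = (P : Matrix _ _ ℂ).map MvPolynomial.C * Matrix.linSubstEntries γ A * (Q : Matrix _ _ ℂ).map MvPolynomial.C ∨
          B = (P : Matrix _ _ ℂ).map MvPolynomial.C * (Matrix.linSubstEntries γ A).transpose *
            (Q : Matrix _ _ ℂ).map MvPolynomial.C) :=
  ⟨uniq_of_halfEq hN hopt, fun huniq D hD hdD =>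
    ProjectionStabilityOptStep.HalfEqOfUniq.stub_halfEq_of_uniq N (by omega) hopt huniq D hD hdD⟩

/-- **The crux is equivalent to the line's bet** (`SymStep` with the extra hypothesis `Opt (n+1)`):
`UniqStep ↔ ∀ n ≥ 3, Opt n → Uniq n → Opt (n+1) → HalfEq (n+1)`.
[cite: LandsbergRessayre2017, Question 2.2] -/
theorem uniqStep_iff_symStep :
    Summit.ValiantsHypothesis.ValiantsHypothesis.Theses.ProjectionStability.UniqStep ↔
    ∀ n ≥ 3, 2 ^ n - 1 ≤ detProjectionComplexity (perPoly (Fin n) ℂ) →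
      (∀ A B : Matrix (Fin (detProjectionComplexity (perPoly (Fin n) ℂ)))
          (Fin (detProjectionComplexity (perPoly (Fin n) ℂ))) (MvPolynomial (Fin n × Fin n) ℂ),
        (∀ i j, (∃ v, A i j = MvPolynomial.X v) ∨ ∃ c, A i j = MvPolynomial.C c) →
        (∀ i j, (∃ v, B i j = MvPolynomial.X v) ∨ ∃ c, B i j = MvPolynomial.C c) →
        A.det = perPoly (Fin n) ℂ → B.det = perPoly (Fin n) ℂ →
        ∃ (P Q : GL (Fin (detProjectionComplexity (perPoly (Fin n) ℂ))) ℂ) (γ : GL (Fin n × Fin n) ℂ),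
          γ ∈ permSymmetrySubst ℂ n ∧
          (B = (P : Matrix _ _ ℂ).map MvPolynomial.C * Matrix.linSubstEntries γ A * (Q : Matrix _ _ ℂ).map MvPolynomial.C ∨
            B = (P : Matrix _ _ ℂ).map MvPolynomial.C * (Matrix.linSubstEntries γ A).transpose *
              (Q : Matrix _ _ ℂ).map MvPolynomial.C)) →
      2 ^ (n + 1) - 1 ≤ detProjectionComplexity (perPoly (Fin (n + 1)) ℂ) →
      ∀ D : Matrix (Fin (detProjectionComplexity (perPoly (Fin (n + 1)) ℂ)))
          (Fin (detProjectionComplexity (perPoly (Fin (n + 1)) ℂ))) (MvPolynomial (Fin (n + 1) × Fin (n + 1)) ℂ),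
        (∀ i j, (∃ v, D i j = X v) ∨ ∃ c, D i j = C c) → D.det = perPoly (Fin (n + 1)) ℂ →
        IsEquivariantDetRepr (leftMonomialSubst ℂ (n + 1)) (perPoly (Fin (n + 1)) ℂ) D ∨
          IsEquivariantDetRepr (leftMonomialSubst ℂ (n + 1)) (perPoly (Fin (n + 1)) ℂ)
            (D.map (rename (Prod.swap : Fin (n + 1) × Fin (n + 1) → Fin (n + 1) × Fin (n + 1)))) := by
  constructor
  · intro hU n hn hopt huniq hopt' D hD hdD
    exact ProjectionStabilityOptStep.HalfEqOfUniq.stub_halfEq_of_uniq (n + 1) (by omega) hopt'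
      (hU n hn hopt huniq hopt') D hD hdD
  · intro hS n hn hopt huniq hopt'
    exact uniq_of_halfEq (by omega) hopt' (hS n hn hopt huniq hopt')

/-- **The crux as pure symmetry propagation**: `UniqStep ↔ ∀ n ≥ 3, Opt n → HalfEq n → Opt (n+1) →
HalfEq (n+1)` — Grenet-optimality and half-symmetry of optimal projections propagate together
(`halfEq_iff_uniq` at both levels). [cite: LandsbergRessayre2017, Question 2.2] -/
theorem uniqStep_iff_halfEq_step :
    Summit.ValiantsHypothesis.ValiantsHypothesis.Theses.ProjectionStability.UniqStep ↔
    ∀ n ≥ 3, 2 ^ n - 1 ≤ detProjectionComplexity (perPoly (Fin n) ℂ) →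
      (∀ D : Matrix (Fin (detProjectionComplexity (perPoly (Fin n) ℂ)))
          (Fin (detProjectionComplexity (perPoly (Fin n) ℂ))) (MvPolynomial (Fin n × Fin n) ℂ),
        (∀ i j, (∃ v, D i j = X v) ∨ ∃ c, D i j = C c) → D.det = perPoly (Fin n) ℂ →
        IsEquivariantDetRepr (leftMonomialSubst ℂ n) (perPoly (Fin n) ℂ) D ∨
          IsEquivariantDetRepr (leftMonomialSubst ℂ n) (perPoly (Fin n) ℂ)
            (D.map (rename (Prod.swap : Fin n × Fin n → Fin n × Fin n)))) →
      2 ^ (n + 1) - 1 ≤ detProjectionComplexity (perPoly (Fin (n + 1)) ℂ) →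
      ∀ D : Matrix (Fin (detProjectionComplexity (perPoly (Fin (n + 1)) ℂ)))
          (Fin (detProjectionComplexity (perPoly (Fin (n + 1)) ℂ))) (MvPolynomial (Fin (n + 1) × Fin (n + 1)) ℂ),
        (∀ i j, (∃ v, D i j = X v) ∨ ∃ c, D i j = C c) → D.det = perPoly (Fin (n + 1)) ℂ →
        IsEquivariantDetRepr (leftMonomialSubst ℂ (n + 1)) (perPoly (Fin (n + 1)) ℂ) D ∨
          IsEquivariantDetRepr (leftMonomialSubst ℂ (n + 1)) (perPoly (Fin (n + 1)) ℂ)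
            (D.map (rename (Prod.swap : Fin (n + 1) × Fin (n + 1) → Fin (n + 1) × Fin (n + 1)))) := by
  rw [uniqStep_iff_symStep]
  refine forall₂_congr fun n hn => forall_congr' fun hopt => ?_
  rw [halfEq_iff_uniq hn hopt]

end

end Summit.ValiantsHypothesis.ValiantsHypothesis.Theorems.ProjectionStabilityUniqStep
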